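/-
Copyright: the b2b-balaban T⁴-continuum CRUX team, row NE7b OWNER lineage `t4-ne7b-p1` (gen 123). Project licence.
-/
import Summits.QuantumFields.BalabanUV.T4Continuum.Spine.NE7b.SupZdCoarseForm

/-!
# THE FINITE SECTIONS OF THE INFINITE-VOLUME COARSE OPERATOR ARE UNIFORMLY INVERTIBLE: for every finite `S ⊂ ℤ^d`, the section
# `(T_∞(b,b′))_{b,b′ ∈ S}` of `T_∞ = Q′H_∞⁻¹Q′*` (`V : ℤ^d → [−λ, Λ]`, `d ≥ 3`, ANY bounded block columns) is injective on functions supported in `S`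
# by [B6]'s floor ((186)), hence — finite-dimensional linear algebra — SOLVABLE: every `k` on `S` is `T_∞m` on `S` for an `m` supported in `S`,
# with the UNIFORM bound `γ²·Σ_S m² ≤ Σ_S k²`, `γ = 1∕(36^d(4d + a + Λ))` independent of `S`, `n`, `V` — the finite-section method's first
# step towards `T_∞⁻¹` (row NE7b, node U5c; (186) BY NAME + Mathlib's `LinearMap.injective_iff_surjective`; [folklore])

Cell `pub-balaban`, sub-cell `t4`, spine estimate NE7b (`T4WeightBudget.RelWeightBound`; the cell's OWN estimate — NOT PRINTED in
[Bałaban 1983–89], NOT PROVED).  Crux-route work under `Spine/NE7b/` by the row OWNER (`t4-ne7b-p1` gen 123, file (193)) under FREEZE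
(0)'s crux-prover clause; NOTHING of Bałaban's is named as a Lean object, valued or asserted; no `T4Continuum/Support` leaf typed; no `def`,
no notation (the entries DISPLAYED; the section's linear map is built inside the proof); zero `sorry`.  Imports (BY NAME): the OWNER's (191)
`…SupZdCoarseForm` (through it (186) `zd_coarse_floor`), Mathlib's `LinearMap.injective_iff_surjective`, `Finset.sum_coe_sort`,
`Finset.sum_mul_sq_le_sq_mul_sq`.

WHY (located).  The infinite-volume next-scale Hessian is `(n+1)^dT_∞⁻¹`; (186)∕(187)∕(189)∕(191) gave floor, symmetry, `ℓ^∞` rows and `ℓ²`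
boundedness of `T_∞`.  The finite-section method inverts `T_∞` as the limit of the inverses of its finite sections, which requires those
inverses to exist with bounds UNIFORM in the section: on functions supported in `S`, `⟨m, T_∞m⟩ ≥ γΣ_S m²` ((186), `g` vanishing off `S`), so
the section is injective, hence surjective (`S` is finite), and `γΣm² ≤ ⟨m, T_∞m⟩ = ⟨m, k⟩ ≤ (Σm²)^{1∕2}(Σk²)^{1∕2}` gives `γ²Σm² ≤ Σk²`.

WHAT IS PROVED ([folklore]; `X d = ℤ^d`; `T_∞(b,b′) = (n+1)^{−d}Σ_{q ∈ B n b}Ψ_{b′} q` DISPLAYED for ANY bounded block columns `Ψ` of `H_V`):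
* §1 `extendByZero_sum` (sums over `S` of the zero-extension of `m : S → ℝ` are sums over the subtype).
* §2 **`zd_coarse_section_solvable`**: `d ≥ 3`, `a > 0`, `λ < min(2,a)`, `Λ ≥ 0` ⟹ for ALL `n`, `V : ℤ^d → [−λ, Λ]`, ANY bounded block columns
  `Ψ`, every finite `S` and every `k : ℤ^d → ℝ`: `∃ m : ℤ^d → ℝ` with `m = 0` off `S`, `Σ_{b′ ∈ S}T_∞(b,b′)m b′ = k b` for every `b ∈ S`, and
  `(1∕(36^d(4d + a + Λ)))²·Σ_{b ∈ S}m b² ≤ Σ_{b ∈ S}k b²`.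
* §3 toy (`d = 3`).

HONEST (what this is NOT).  Finite sections only — the limit `S ↑ ℤ^d` of the section inverses (existence of `T_∞⁻¹`, its decay by a
Combes–Thomas argument uniform in `S`, and the identification with the road's next-scale Hessian) is the sequel; `d ≥ 3` only; the LINEAR
column only; scalar skeleton ((A3), NC-NE7b-α UNRULED); nothing of the covariant propagators of [B4]–[B6]; [B6] (2.76) is the printed MODEL of
the floor — locator only; nothing of Bałaban's.  BY-NAME EFFECT ON THE WALL: NONE.  NE7b NOT PRINTED ∕ NOT PROVED; spine PROVED 0∕9; rung
(B)+1 — the programme's measures remain FINITE-torus statements; NOT the mass gap, NOT Clay.  HONEST DEPENDENCY: continuum YM on T⁴ ⇐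
BetaPertH ∧ nine spine estimates (0∕9 proved); BetaPertH ⇐ (D1) ∧ (D4) ∧ CAP+tail; G-an2-4 gates asym, D1 and NE2∕3∕4.
-/

set_option autoImplicit false

noncomputable section

namespace Summit.QuantumFields.BalabanUV.T4Continuum.NE7b.SupZdCoarseSections

open Real
open Literature.MathematicalPhysics.QuantumFieldTheory.Balaban1983to89
open B6QGQLower276 (X e blk B side chart mem_B sum_B sum_B_const card_cube blk_chart)
open SupZdCoarseOperator (zd_coarse_floor)

variable {d : ℕ}

/-! ## §1. Zero-extensions of functions on a finite set -/

/-- Sums over `S` of the zero-extension of `m : S → ℝ` are sums over the subtype: `Σ_{b ∈ S}F b (ext m b) = Σ_{b : S}F b (m b)`. [folklore] -/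
theorem extendByZero_sum (S : Finset (X d)) (m : S → ℝ) (F : X d → ℝ → ℝ) :
    ∑ b ∈ S, F b (if h : b ∈ S then m ⟨b, h⟩ else 0) = ∑ b : S, F b (m b) := by
  classical
  rw [← Finset.sum_coe_sort S]
  exact Finset.sum_congr rfl fun b _ => by rw [dif_pos b.2]

/-! ## §2. THE END: the finite sections of `T_∞` are solvable with a uniform bound -/

/-- **HEADLINE — THE FINITE SECTIONS OF `T_∞` ARE UNIFORMLY INVERTIBLE**: for ALL `n`, `V : ℤ^d → [−λ, Λ]`, ANY bounded block columns `Ψ` of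
`H_V`, every finite `S ⊂ ℤ^d` and every `k`: there is `m` supported in `S` with `Σ_{b′ ∈ S}T_∞(b,b′)m b′ = k b` on `S` and `γ²Σ_S m² ≤ Σ_S k²`,
`γ = 1∕(36^d(4d + a + Λ))` — injectivity by (186)'s floor, surjectivity by finite dimension, the bound by the floor and Cauchy–Schwarz.
[folklore] -/
theorem zd_coarse_section_solvable (hd : 3 ≤ d) (a : ℝ) (ha : 0 < a) {lam Lam : ℝ} (hlam : lam < min 2 a) (hLam : 0 ≤ Lam)
    (n : ℕ) (V : X d → ℝ) (hV : ∀ p, -lam ≤ V p) (hV' : ∀ p, V p ≤ Lam)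
    (Ψ : X d → X d → ℝ) (BΨ : X d → ℝ) (hΨB : ∀ b' p, |Ψ b' p| ≤ BΨ b')
    (hΨ : ∀ b' p, ((n : ℝ) + 1) ^ 2 * ∑ μ, (2 * Ψ b' p - Ψ b' (p + e μ) - Ψ b' (p - e μ))
      + a / ((n : ℝ) + 1) ^ d * ∑ q ∈ B n (blk n p), Ψ b' q + V p * Ψ b' p = if blk n p = b' then 1 else 0)
    (S : Finset (X d)) (k : X d → ℝ) :
    ∃ m : X d → ℝ, (∀ b, b ∉ S → m b = 0) ∧
      (∀ b ∈ S, ∑ b' ∈ S, ((((n : ℝ) + 1) ^ d)⁻¹ * ∑ q ∈ B n b, Ψ b' q) * m b' = k b) ∧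
      (1 / ((36 : ℝ) ^ d * (4 * d + a + Lam))) ^ 2 * ∑ b ∈ S, m b ^ 2 ≤ ∑ b ∈ S, k b ^ 2 := by
  classical
  -- the entries and [B6]'s floor on functions supported in `S`
  obtain ⟨Tf, hTf⟩ : ∃ Tf : X d → X d → ℝ, ∀ b b', Tf b b' = (((n : ℝ) + 1) ^ d)⁻¹ * ∑ q ∈ B n b, Ψ b' q := ⟨_, fun _ _ => rfl⟩
  set γ : ℝ := 1 / ((36 : ℝ) ^ d * (4 * d + a + Lam)) with hγ
  have hγ0 : 0 < γ := by positivity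
  have hfloor : ∀ g : X d → ℝ, (∀ b, b ∉ S → g b = 0) → γ * ∑ b ∈ S, g b ^ 2 ≤ ∑ b ∈ S, g b * ∑ b' ∈ S, Tf b b' * g b' := by
    intro g hg
    have h := zd_coarse_floor hd a ha hlam hLam n V hV hV' Ψ BΨ hΨB hΨ S g hg
    simp only [← hTf] at h
    exact h
  -- the section as a linear map on `S → ℝ`
  let L : (S → ℝ) →ₗ[ℝ] (S → ℝ) :=
    { toFun := fun m b => ∑ b' : S, Tf b b' * m b'
      map_add' := fun m m' => funext fun b => by
        simp only [Pi.add_apply, mul_add, Finset.sum_add_distrib]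
      map_smul' := fun c m => funext fun b => by
        simp only [Pi.smul_apply, smul_eq_mul, RingHom.id_apply, Finset.mul_sum]
        exact Finset.sum_congr rfl fun b' _ => by ring }
  have hL : ∀ (m : S → ℝ) (b : S), L m b = ∑ b' : S, Tf b b' * m b' := fun _ _ => rfl
  -- the quadratic form of the section is the quadratic form of `T_∞` on the zero-extension
  have hform : ∀ m : S → ℝ, ∑ b ∈ S, (if h : b ∈ S then m ⟨b, h⟩ else 0)
      * ∑ b' ∈ S, Tf b b' * (if h : b' ∈ S then m ⟨b', h⟩ else 0) = ∑ b : S, m b * L m b := by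
    intro m
    rw [extendByZero_sum S m (fun b x => x * ∑ b' ∈ S, Tf b b' * (if h : b' ∈ S then m ⟨b', h⟩ else 0))]
    refine Finset.sum_congr rfl fun b _ => ?_
    rw [hL, extendByZero_sum S m (fun b' x => Tf b b' * x)]
  have hsq : ∀ m : S → ℝ, ∑ b ∈ S, (if h : b ∈ S then m ⟨b, h⟩ else 0) ^ 2 = ∑ b : S, m b ^ 2 :=
    fun m => extendByZero_sum S m (fun _ x => x ^ 2)
  -- injective by the floor
  have hinj : Function.Injective L := by
    refine (injective_iff_map_eq_zero L).2 fun m hm => ?_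
    have hzero : ∀ b, b ∉ S → (fun b => if h : b ∈ S then m ⟨b, h⟩ else (0 : ℝ)) b = 0 := fun b hb => by
      simp only [dif_neg hb]
    have h := hfloor (fun b => if h : b ∈ S then m ⟨b, h⟩ else 0) hzero
    rw [hform m, hsq m] at h
    simp only [hm, Pi.zero_apply, mul_zero, Finset.sum_const_zero] at h
    have hsum0 : ∑ b : S, m b ^ 2 = 0 :=
      le_antisymm (by nlinarith [Finset.sum_nonneg fun (b : S) (_ : b ∈ Finset.univ) => sq_nonneg (m b)])
        (Finset.sum_nonneg fun b _ => sq_nonneg _)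
    funext b
    have := (Finset.sum_eq_zero_iff_of_nonneg fun (b : S) (_ : b ∈ Finset.univ) => sq_nonneg (m b)).1 hsum0 b (Finset.mem_univ b)
    simpa using this
  -- hence surjective: solve the section for `k`
  have hsurj : Function.Surjective L := LinearMap.injective_iff_surjective.1 hinj
  obtain ⟨m, hmk⟩ := hsurj fun b : S => k b
  refine ⟨fun b => if h : b ∈ S then m ⟨b, h⟩ else 0, fun b hb => by simp only [dif_neg hb], fun b hb => ?_, ?_⟩
  · -- the equation on `S`
    have h := congrFun hmk ⟨b, hb⟩
    rw [hL] at h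
    rw [← h, ← extendByZero_sum S m (fun b' x => Tf b b' * x)]
    exact Finset.sum_congr rfl fun b' _ => by rw [hTf]
  · -- the uniform bound: `γΣm² ≤ ⟨m, T_∞m⟩ = ⟨m, k⟩ ≤ (Σm²)^{1∕2}(Σk²)^{1∕2}`
    have hzero : ∀ b, b ∉ S → (fun b => if h : b ∈ S then m ⟨b, h⟩ else (0 : ℝ)) b = 0 := fun b hb => by simp only [dif_neg hb]
    have h1 := hfloor (fun b => if h : b ∈ S then m ⟨b, h⟩ else 0) hzero
    rw [hform m] at h1
    simp only [hmk] at h1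
    -- `⟨m, k⟩` over the subtype is `Σ_{b ∈ S} ext m b · k b`
    have hmk' : ∑ b : S, m b * k b = ∑ b ∈ S, (if h : b ∈ S then m ⟨b, h⟩ else 0) * k b :=
      (extendByZero_sum S m (fun b x => x * k b)).symm
    rw [hmk'] at h1
    have hCS := Finset.sum_mul_sq_le_sq_mul_sq S (fun b => if h : b ∈ S then m ⟨b, h⟩ else 0) k
    set Xm : ℝ := ∑ b ∈ S, (if h : b ∈ S then m ⟨b, h⟩ else 0) ^ 2 with hXm
    have hXm0 : 0 ≤ Xm := Finset.sum_nonneg fun _ _ => sq_nonneg _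
    have hY0 : 0 ≤ ∑ b ∈ S, k b ^ 2 := Finset.sum_nonneg fun _ _ => sq_nonneg _
    -- `γ²Xm² ≤ (Σ ext m·k)² ≤ Xm·Σk²`
    have h2 : (γ * Xm) ^ 2 ≤ Xm * ∑ b ∈ S, k b ^ 2 := by
      have h3 : 0 ≤ γ * Xm := by positivity
      calc (γ * Xm) ^ 2 ≤ (∑ b ∈ S, (if h : b ∈ S then m ⟨b, h⟩ else 0) * k b) ^ 2 := pow_le_pow_left₀ h3 h1 2
        _ ≤ Xm * ∑ b ∈ S, k b ^ 2 := hCS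
    by_cases hX : Xm = 0
    · rw [hX, mul_zero]; exact hY0
    · have hXpos : 0 < Xm := lt_of_le_of_ne hXm0 (Ne.symm hX)
      have h4 : γ ^ 2 * Xm * Xm ≤ (∑ b ∈ S, k b ^ 2) * Xm := by nlinarith
      exact le_of_mul_le_mul_right h4 hXpos

/-! ## §3. Toy -/

/-- Toy (`d = 3`): the zero-extension bookkeeping on the empty section. -/
example (m : ((∅ : Finset (X 3)) : Finset (X 3)) → ℝ) :
    ∑ b ∈ (∅ : Finset (X 3)), (fun _ (x : ℝ) => x) b (if h : b ∈ (∅ : Finset (X 3)) then m ⟨b, h⟩ else 0)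
      = ∑ b : ((∅ : Finset (X 3)) : Finset (X 3)), (fun _ (x : ℝ) => x) b (m b) :=
  extendByZero_sum (d := 3) ∅ m (fun _ x => x)

end Summit.QuantumFields.BalabanUV.T4Continuum.NE7b.SupZdCoarseSections
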